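import Summits.RiemannHypothesis.RiemannHypothesis.Theorems.GroundBartaEvenWinsBeyondArchDeflationCertBridgeWInnerSliver
import HarnessLib

/-!
# RiemannHypothesis / GroundBarta — rung 4 machinery (`EvenWinsBeyondArch`, stmt-RiemannHypothesis-18807 / 18085):
# the weighted deflated Temple L-side from a two-prime certificate — trial vectors cut INSIDE the window

Helper file (`--supports stmt-RiemannHypothesis-18085`), RH-free, no definitions, no named facts.  Prover A (g10 of
unit `sr-gb-rung-a`), endpoint cell `(log 5)/2`.

The endpoint version of `dt_weil{Even,Odd}GroundEnergy_ge_of_deflCert_w` (files …CertBridgeW / …CertBridgeWEven).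
Window `c` (the target, e.g. `c = (log 5)/2`), a rational cut `0 < c' ≤ c`, a certificate support `a₀ ≥ c`:

* the two-prime certificate at level `β₂₃` lives on the sector tests of `[-a₀, a₀]` and its penalties are the
  polynomials `p_r = maskPoly (R_r) n a₀`;
* the trial vectors are `v_r = 𝟙_{[-c',c']} · g_r` with `g_r ∈ C¹` of the sector's parity, `g_r(c') = 0`
  (edge-vanishing, `dt_sector_bound_of_ritz_w_inner`), and the certificate's polynomials APPROXIMATE them on the window:
  `|p_r − g_r| ≤ ε` on `[-c, c]` (the endpoint certificate's penalties are the trial polynomials rescaled to `a₀` and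
  rounded to `2⁻¹⁴⁰`);
* on a test `φ` supported in `[-c, c]` the certificate's penalty is `|⟨φ, 𝟙_{[-c,c]} p_r⟩|²`, which differs from
  `|⟨φ, v_r⟩|²` by the rounding and by the SLIVER `c' < |x| ≤ c`:
  `|⟨φ, 𝟙_{[-c,c]}p_r⟩|² ≤ 4|⟨φ, v_r⟩|² + 4·(2(b⁺−c')B²)·∫_{|x|>c'}|φ|² + 2·(2cε²)·∫|φ|²` for any `b⁺ ≥ c` and
  `B ≥ |g_r|` on `c' < |x| ≤ b⁺` (`dt_sliver_penalty_le'`, Cauchy–Schwarz).  Both error terms are absorbed into the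
  pointwise complement level: THREE-level weight `w = wI` on `|y| < y₁`, `wE` on `y₁ ≤ |y| ≤ c'`, `wS` on `|y| > c'`,
  with `1/wI ≤ β₂₃ − λ − η₀`, `1/wE ≤ β₂₃ − κ₂ − λ − η₀`, `1/wS ≤ β₂₃ − κ₂ − λ − η₀ − η`, `η₀ = 4cε² Σ_r μ_r`,
  `η = 8(b⁺ − c')B² Σ_r μ_r` (INEQUALITIES: any larger weights are admissible, so `λ` is not pinned by the R-layer's
  weights);
* the window images, prime index, killing constant and the weighted PSD datum are those of the window `c`.

* `dt_sliver_penalty_le` — the sliver estimate;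
* `dt_sector_bound_of_deflCert_w_inner` — parity `σ`, the master statement (`λ∫|φ|² ≤ Re Q(φ)` on sector tests of `[-c,c]`);
* `dt_weilEvenGroundEnergy_ge_of_deflCert_w_inner`, `dt_weilOddGroundEnergy_ge_of_deflCert_w_inner` — `λ ≤ ε_ev(c)`,
  `λ ≤ ε_od(c)`.
-/

set_option linter.dupNamespace false

noncomputable section

open MeasureTheory Set Filter
open scoped Topology ComplexConjugate BigOperators

namespace Summit.RiemannHypothesis.RiemannHypothesis.Theorems.EvenWinsBeyondArch

open Literature.NumberTheory.LFunctions
open Summit.RiemannHypothesis.RiemannHypothesis.Theorems.OddSector (weilDirichletEnergy₂ weilPoleForm₂)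
open Summit.RiemannHypothesis.RiemannHypothesis.Theorems.GroundStateSimpleEven (incs_memLp)

/-- **The weighted deflated Temple sector bound from a rank-one augmented two-prime certificate, trial vectors cut
inside the window** (parity `σ = ±1`).  Window `0 < c' ≤ c ≤ a₀`, `c ≤ (log 5)/2`, `c ≤ b⁺`; certificate conclusion
`hcert23` at level `β₂₃` on the `σ`-sector tests of `[-a₀, a₀]` (penalty data `R`, non-negative weights, moments of
order `< n`); trial vectors `v_i = 𝟙_{[-c',c']} · g_i`, `g_i ∈ C¹` of parity `σ` with `g_i(c') = 0`,
`|maskPoly (R_i) n a₀ − g_i| ≤ ε` on `[-c, c]` and `|g_i| ≤ B` on `c' < |x| ≤ b⁺`; window images at `c`; a majorant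
`κ₂ ≥ (log 2)/2`; a threshold `y₁ ≤ log 4 − c`, `y₁ ≤ c'`; positive weights `wI, wE, wS` with
`1/wI ≤ β₂₃ − λ − η₀`, `1/wE ≤ β₂₃ − κ₂ − λ − η₀`, `1/wS ≤ β₂₃ − κ₂ − λ − η₀ − η` (`η₀ = 4cε² Σμ`,
`η = 8(b⁺ − c')B² Σμ`); and the WEIGHTED PSD datum `A − λG − R_w ⪰ 0` at the window `c` with the three-level weight.  Conclusion: `λ ∫|φ|² ≤ Re Q(φ)` for every smooth `σ`-sector test `φ` supported in `[-c, c]`.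
[folklore] -/
theorem dt_sector_bound_of_deflCert_w_inner (σ : ℝ) {c c' : ℝ} (hc' : 0 < c') (hcc : c' ≤ c)
    (hc5 : c ≤ Real.log 5 / 2) {a₀ : ℝ} (hca : c ≤ a₀) {bp : ℝ} (hcb : c ≤ bp)
    (R : List (ℚ × ℕ × List ℚ)) (n : ℕ) {β₂₃ : ℝ}
    (hRμ : ∀ i : Fin R.length, 0 ≤ (R.get i).1)
    (hcert23 : ∀ g : ℝ → ℂ, IsWeilTest g → tsupport g ⊆ Icc (-a₀) a₀ → (∀ x, g (-x) = (σ : ℂ) * g x) →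
      β₂₃ * weilNorm2Sq g ≤ weilTwoPrimeQuadratic g +
        (R.map fun r ↦ (r.1 : ℝ) * ‖∑ k ∈ Finset.range n, ((maskV r k : ℚ) : ℂ) * weilMoment a₀ g k‖ ^ 2).sum)
    (g : Fin R.length → ℝ → ℝ) (hg : ∀ i, ContDiff ℝ 1 (g i)) (hgσ : ∀ i x, g i (-x) = σ * g i x)
    (hg0 : ∀ i, g i c' = 0)
    {ε : ℝ} (hε0 : 0 ≤ ε) (hε : ∀ i, ∀ x ∈ Icc (-c) c, |maskPoly (R.get i) n a₀ x - g i x| ≤ ε)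
    (v F : Fin R.length → ℝ → ℂ)
    (hv : ∀ i x, v i x = (((Icc (-c') c').indicator (g i) x : ℝ) : ℂ))
    {B : ℝ} (hB0 : 0 ≤ B) (hB : ∀ i : Fin R.length, ∀ x, c' < |x| → |x| ≤ bp → |g i x| ≤ B)
    (hF : ∀ i y, F i y = (Icc (-c) c).indicator (fun y ↦
        2 * (∫ x, v i x * (Real.cosh (x / 2) : ℂ)) * (Real.cosh (y / 2) : ℂ) -
          2 * (∫ x, v i x * (Real.sinh (x / 2) : ℂ)) * (Real.sinh (y / 2) : ℂ) +
        (∑ m ∈ weilPrimeIndex c, (((ArithmeticFunction.vonMangoldt m : ℝ) / Real.sqrt m : ℝ) : ℂ) *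
          (2 * v i y - v i (y - Real.log m) - v i (y + Real.log m))) +
        ∫ t in Ioi 0, (weilArchDensity t : ℂ) * (2 * v i y - v i (y - t) - v i (y + t))) y -
      (weilMarkovConstant c : ℂ) * v i y)
    (W : Fin R.length → Fin R.length → ℝ) {κ₂ : ℝ} (hκ : Real.log 2 / 2 ≤ κ₂) (lam : ℝ)
    {y₁ : ℝ} (hy : y₁ ≤ Real.log 4 - c) (hyc : y₁ ≤ c')
    {wI wE wS : ℝ} (hwI0 : 0 < wI) (hwE0 : 0 < wE) (hwS0 : 0 < wS)
    (hwI : 1 / wI ≤ β₂₃ - lam - 4 * (c * ε ^ 2) * ∑ i : Fin R.length, ((R.get i).1 : ℝ))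
    (hwE : 1 / wE ≤ β₂₃ - κ₂ - lam - 4 * (c * ε ^ 2) * ∑ i : Fin R.length, ((R.get i).1 : ℝ))
    (hwS : 1 / wS ≤ β₂₃ - κ₂ - lam - 4 * (c * ε ^ 2) * ∑ i : Fin R.length, ((R.get i).1 : ℝ) -
      8 * ((bp - c') * B ^ 2) * ∑ i : Fin R.length, ((R.get i).1 : ℝ))
    (hPSD : ∀ α : Fin R.length → ℝ, 0 ≤ ∑ i, ∑ j, α i * α j *
      ((weilPoleForm₂ (v i) (v j) + weilDirichletEnergy₂ c (v i) (v j) -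
          weilMarkovConstant c * ∫ x, (v i x * conj (v j x)).re) - lam * (∫ x, (v i x * conj (v j x)).re) -
        ∫ y, {u : ℝ | c' < |u|}.piecewise (fun _ ↦ wS)
            ({u : ℝ | y₁ ≤ |u|}.piecewise (fun _ ↦ wE) (fun _ ↦ wI)) y *
          ((F i - ∑ l, W i l • v l) y * conj ((F j - ∑ l, W j l • v l) y)).re))
    {φ : ℝ → ℂ} (hφ : IsWeilTest φ) (hφs : tsupport φ ⊆ Icc (-c) c) (hφp : ∀ x, φ (-x) = (σ : ℂ) * φ x) :
    lam * ∫ x, ‖φ x‖ ^ 2 ≤ (weilQuadratic φ).re := by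
  have hE : MeasurableSet {u : ℝ | y₁ ≤ |u|} := measurableSet_le measurable_const continuous_abs.measurable
  have hS : MeasurableSet {u : ℝ | c' < |u|} := measurableSet_lt measurable_const continuous_abs.measurable
  set E : Set ℝ := {u : ℝ | y₁ ≤ |u|} with hEdef
  set S : Set ℝ := {u : ℝ | c' < |u|} with hSdef
  set w : ℝ → ℝ := S.piecewise (fun _ ↦ wS) (E.piecewise (fun _ ↦ wE) (fun _ ↦ wI)) with hwdef
  set η : ℝ := 8 * ((bp - c') * B ^ 2) * ∑ i : Fin R.length, ((R.get i).1 : ℝ) with hηdef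
  set η₀ : ℝ := 4 * (c * ε ^ 2) * ∑ i : Fin R.length, ((R.get i).1 : ℝ) with hη₀def
  -- values of the weight
  have hw_S : ∀ y, y ∈ S → w y = wS := fun y hy ↦ by rw [hwdef, Set.piecewise_eq_of_mem _ _ _ hy]
  have hw_E : ∀ y, y ∉ S → y ∈ E → w y = wE := fun y hy hy' ↦ by
    rw [hwdef, Set.piecewise_eq_of_notMem _ _ _ hy, Set.piecewise_eq_of_mem _ _ _ hy']
  have hw_I : ∀ y, y ∉ S → y ∉ E → w y = wI := fun y hy hy' ↦ by
    rw [hwdef, Set.piecewise_eq_of_notMem _ _ _ hy, Set.piecewise_eq_of_notMem _ _ _ hy']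
  have hw_cases : ∀ y, w y = wS ∨ w y = wE ∨ w y = wI := by
    intro y
    by_cases h1 : y ∈ S
    · exact Or.inl (hw_S y h1)
    · by_cases h2 : y ∈ E
      · exact Or.inr (Or.inl (hw_E y h1 h2))
      · exact Or.inr (Or.inr (hw_I y h1 h2))
  have hwpos : ∀ y, 0 < w y := by
    intro y; rcases hw_cases y with h | h | h <;> rw [h] <;> assumption
  have hwm : Measurable w :=
    Measurable.piecewise hS measurable_const (Measurable.piecewise hE measurable_const measurable_const)
  set C : ℝ := wI + wE + wS + (1 / wI + 1 / wE + 1 / wS) with hCdef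
  have hwC : ∀ y, |w y| ≤ C := by
    intro y
    have h1 : 0 < 1 / wI := by positivity
    have h2 : 0 < 1 / wE := by positivity
    have h3 : 0 < 1 / wS := by positivity
    rcases hw_cases y with h | h | h <;> rw [h, abs_of_pos (by assumption), hCdef] <;> linarith
  have hnC : ∀ y, |1 / w y| ≤ C := by
    intro y
    have h1 : 0 < 1 / wI := by positivity
    have h2 : 0 < 1 / wE := by positivity
    have h3 : 0 < 1 / wS := by positivity
    rcases hw_cases y with h | h | h <;> rw [h, abs_of_pos (by positivity), hCdef] <;> linarith
  refine dt_sector_bound_of_ritz_w_inner hc' hcc σ g hg hgσ hg0 v F hv hF W (fun i ↦ 4 * ((R.get i).1 : ℝ)) lam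
    (fun i ↦ by have : (0 : ℝ) ≤ ((R.get i).1 : ℝ) := (by exact_mod_cast hRμ i); linarith)
    (n := fun y ↦ 1 / w y) (w := w) (C := C) (measurable_const.div hwm) hwm hnC hwC
    (fun y ↦ (one_div_pos.2 (hwpos y)).le) (fun y ↦ (hwpos y).le)
    (fun y ↦ mul_one_div_cancel (hwpos y).ne') ?_ hPSD hφ hφs hφp
  -- the weighted certificate on smooth sector tests of `[-c, c]`
  intro φ hφ hφs hφp
  have hφa : tsupport φ ⊆ Icc (-a₀) a₀ := hφs.trans (Icc_subset_Icc (by linarith) hca)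
  have h23 := hcert23 φ hφ hφa hφp
  have hsl := dt_weilTwoPrimeQuadratic_sub_edge_le_weilQuadratic_re hφ hφs hc5 hy
  have hnorm : weilNorm2Sq φ = ∫ x, ‖φ x‖ ^ 2 := rfl
  have h2i : Integrable fun u : ℝ ↦ ‖φ u‖ ^ 2 := hφ.integrable_norm_sq
  -- the certificate's penalty, term by term, against the sliver estimate
  have hsum : (R.map fun r ↦ (r.1 : ℝ) * ‖∑ k ∈ Finset.range n, ((maskV r k : ℚ) : ℂ) * weilMoment a₀ φ k‖ ^ 2).sum =
      ∑ i : Fin R.length, ((R.get i).1 : ℝ) *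
        ‖∫ x, φ x * conj ((((Icc (-c) c).indicator (fun x ↦ maskPoly (R.get i) n a₀ x) x : ℝ) : ℂ))‖ ^ 2 := by
    rw [dt_list_sum_map_eq_sum_get]
    refine Finset.sum_congr rfl fun i _ ↦ ?_
    rw [dt_rankOne_term_eq (R.get i) n a₀ hφ hφs]
  set Y : ℝ := ∫ x, S.indicator (fun u ↦ ‖φ u‖ ^ 2) x with hYdef
  set Nφ : ℝ := ∫ x, ‖φ x‖ ^ 2 with hNdef
  set K : ℝ := 2 * (bp - c') * B ^ 2 with hKdef
  have hY0 : 0 ≤ Y := integral_nonneg fun x ↦ indicator_nonneg (fun _ _ ↦ by positivity) _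
  have hN0 : 0 ≤ Nφ := integral_nonneg fun x ↦ by positivity
  have hK0 : 0 ≤ K := by rw [hKdef]; have : 0 ≤ bp - c' := (by linarith); positivity
  have hc0 : 0 ≤ c := hc'.le.trans hcc
  have hterm : ∀ i : Fin R.length, ((R.get i).1 : ℝ) *
      ‖∫ x, φ x * conj ((((Icc (-c) c).indicator (fun x ↦ maskPoly (R.get i) n a₀ x) x : ℝ) : ℂ))‖ ^ 2 ≤
      4 * ((R.get i).1 : ℝ) * ‖∫ x, φ x * conj (v i x)‖ ^ 2 +
        ((R.get i).1 : ℝ) * (4 * K * Y + 2 * (2 * c * ε ^ 2) * Nφ) := by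
    intro i
    have hμ0 : 0 ≤ ((R.get i).1 : ℝ) := by exact_mod_cast hRμ i
    have hs := dt_sliver_penalty_le' hφ hc0 hcc hcb (g i) (fun x ↦ maskPoly (R.get i) n a₀ x) (hg i).continuous
      (contDiff_maskPoly (R.get i) n a₀ (m := 0)).continuous (hB i) hB0 (hε i) hε0 (v i) (hv i)
    have := mul_le_mul_of_nonneg_left hs hμ0
    rw [← hKdef, ← hYdef, ← hNdef] at this
    linarith
  have hpen : (∑ i : Fin R.length, ((R.get i).1 : ℝ) *
      ‖∫ x, φ x * conj ((((Icc (-c) c).indicator (fun x ↦ maskPoly (R.get i) n a₀ x) x : ℝ) : ℂ))‖ ^ 2) ≤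
      (∑ i : Fin R.length, 4 * ((R.get i).1 : ℝ) * ‖∫ x, φ x * conj (v i x)‖ ^ 2) +
        (∑ i : Fin R.length, ((R.get i).1 : ℝ)) * (4 * K * Y + 2 * (2 * c * ε ^ 2) * Nφ) := by
    rw [Finset.sum_mul, ← Finset.sum_add_distrib]
    exact Finset.sum_le_sum fun i _ ↦ hterm i
  -- the pointwise level `n = 1/w` is below `n₀ = (β₂₃ − λ) − κ₂ 𝟙_E − η 𝟙_S`
  have hEI := h2i.indicator hE
  have hSI := h2i.indicator hS
  have hni : Integrable fun y ↦ (1 / w y) * ‖φ y‖ ^ 2 :=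
    h2i.bdd_mul (measurable_const.div hwm).aestronglyMeasurable
      (Eventually.of_forall fun y ↦ by rw [Real.norm_eq_abs]; exact hnC y)
  have hn0i : Integrable fun y ↦ (β₂₃ - lam - η₀) * ‖φ y‖ ^ 2 - κ₂ * E.indicator (fun u ↦ ‖φ u‖ ^ 2) y -
      η * S.indicator (fun u ↦ ‖φ u‖ ^ 2) y :=
    ((h2i.const_mul _).sub (hEI.const_mul _)).sub (hSI.const_mul _)
  have hle : ∀ y, (1 / w y) * ‖φ y‖ ^ 2 ≤ (β₂₃ - lam - η₀) * ‖φ y‖ ^ 2 - κ₂ * E.indicator (fun u ↦ ‖φ u‖ ^ 2) y -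
      η * S.indicator (fun u ↦ ‖φ u‖ ^ 2) y := by
    intro y
    have hφ0 : 0 ≤ ‖φ y‖ ^ 2 := by positivity
    by_cases h1 : y ∈ S
    · have h2 : y ∈ E := by
        show y₁ ≤ |y|
        have : c' < |y| := h1
        linarith
      rw [hw_S y h1, indicator_of_mem h2, indicator_of_mem h1]
      have : 1 / wS ≤ β₂₃ - κ₂ - lam - η₀ - η := hwS
      linarith [mul_le_mul_of_nonneg_right this hφ0]
    · by_cases h2 : y ∈ E
      · rw [hw_E y h1 h2, indicator_of_mem h2, indicator_of_notMem h1, mul_zero, sub_zero]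
        have : 1 / wE ≤ β₂₃ - κ₂ - lam - η₀ := hwE
        linarith [mul_le_mul_of_nonneg_right this hφ0]
      · rw [hw_I y h1 h2, indicator_of_notMem h2, indicator_of_notMem h1, mul_zero, sub_zero, mul_zero, sub_zero]
        have : 1 / wI ≤ β₂₃ - lam - η₀ := hwI
        linarith [mul_le_mul_of_nonneg_right this hφ0]
  have hnle : (∫ y, (1 / w y) * ‖φ y‖ ^ 2) ≤ (β₂₃ - lam - η₀) * (∫ y, ‖φ y‖ ^ 2) -
      κ₂ * (∫ y, E.indicator (fun u ↦ ‖φ u‖ ^ 2) y) - η * Y := by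
    have h1 := integral_mono hni hn0i hle
    have hA : Integrable fun y ↦ (β₂₃ - lam - η₀) * ‖φ y‖ ^ 2 := h2i.const_mul _
    have hBi : Integrable fun y ↦ κ₂ * E.indicator (fun u ↦ ‖φ u‖ ^ 2) y := hEI.const_mul _
    have hCi : Integrable fun y ↦ η * S.indicator (fun u ↦ ‖φ u‖ ^ 2) y := hSI.const_mul _
    have eA : ∫ y, (β₂₃ - lam - η₀) * ‖φ y‖ ^ 2 = (β₂₃ - lam - η₀) * ∫ y, ‖φ y‖ ^ 2 := integral_const_mul _ _
    have eB : ∫ y, κ₂ * E.indicator (fun u ↦ ‖φ u‖ ^ 2) y = κ₂ * ∫ y, E.indicator (fun u ↦ ‖φ u‖ ^ 2) y :=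
      integral_const_mul _ _
    have eC : ∫ y, η * S.indicator (fun u ↦ ‖φ u‖ ^ 2) y = η * Y := by rw [hYdef]; exact integral_const_mul _ _
    have eAB : ∫ y, ((β₂₃ - lam - η₀) * ‖φ y‖ ^ 2 - κ₂ * E.indicator (fun u ↦ ‖φ u‖ ^ 2) y) =
        (β₂₃ - lam - η₀) * (∫ y, ‖φ y‖ ^ 2) - κ₂ * ∫ y, E.indicator (fun u ↦ ‖φ u‖ ^ 2) y := by
      rw [integral_sub hA hBi, eA, eB]
    have hABi : Integrable fun y ↦ (β₂₃ - lam - η₀) * ‖φ y‖ ^ 2 - κ₂ * E.indicator (fun u ↦ ‖φ u‖ ^ 2) y :=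
      hA.sub hBi
    have h2 : ∫ y, ((β₂₃ - lam - η₀) * ‖φ y‖ ^ 2 - κ₂ * E.indicator (fun u ↦ ‖φ u‖ ^ 2) y -
        η * S.indicator (fun u ↦ ‖φ u‖ ^ 2) y) = (β₂₃ - lam - η₀) * (∫ y, ‖φ y‖ ^ 2) -
        κ₂ * (∫ y, E.indicator (fun u ↦ ‖φ u‖ ^ 2) y) - η * Y := by
      rw [integral_sub hABi hCi, eAB, eC]
    rw [h2] at h1
    exact h1
  -- combine
  have hX0 : 0 ≤ ∫ y, E.indicator (fun u ↦ ‖φ u‖ ^ 2) y :=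
    integral_nonneg fun y ↦ indicator_nonneg (fun _ _ ↦ by positivity) _
  have hκX := mul_le_mul_of_nonneg_right hκ hX0
  rw [hsum, hnorm] at h23
  rw [← hNdef] at hnle
  have hηKY : η * Y + η₀ * Nφ = (∑ i : Fin R.length, ((R.get i).1 : ℝ)) * (4 * K * Y + 2 * (2 * c * ε ^ 2) * Nφ) := by
    rw [hηdef, hη₀def, hKdef]; ring
  linarith only [hpen, hnle, h23, hsl, hκX, hηKY]

/-- **The deflated Temple EVEN-sector bound from a rank-one augmented two-prime certificate, trial vectors cut inside
the window.**  `λ ≤ ε_ev(c)` under the hypotheses of `dt_sector_bound_of_deflCert_w_inner` with even trial polynomials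
and the certificate on the even tests of `[-a₀, a₀]`. [folklore] -/
theorem dt_weilEvenGroundEnergy_ge_of_deflCert_w_inner {c c' : ℝ} (hc' : 0 < c') (hcc : c' ≤ c)
    (hc5 : c ≤ Real.log 5 / 2) {a₀ : ℝ} (hca : c ≤ a₀) {bp : ℝ} (hcb : c ≤ bp)
    (R : List (ℚ × ℕ × List ℚ)) (n : ℕ) {β₂₃ : ℝ}
    (hRμ : ∀ i : Fin R.length, 0 ≤ (R.get i).1)
    (hcert23 : ∀ f : ℝ → ℂ, IsWeilTest f → tsupport f ⊆ Icc (-a₀) a₀ → (∀ x, f (-x) = f x) →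
      β₂₃ * weilNorm2Sq f ≤ weilTwoPrimeQuadratic f +
        (R.map fun r ↦ (r.1 : ℝ) * ‖∑ k ∈ Finset.range n, ((maskV r k : ℚ) : ℂ) * weilMoment a₀ f k‖ ^ 2).sum)
    (g : Fin R.length → ℝ → ℝ) (hg : ∀ i, ContDiff ℝ 1 (g i)) (hge : ∀ i x, g i (-x) = g i x)
    (hg0 : ∀ i, g i c' = 0)
    {ε : ℝ} (hε0 : 0 ≤ ε) (hε : ∀ i, ∀ x ∈ Icc (-c) c, |maskPoly (R.get i) n a₀ x - g i x| ≤ ε)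
    (v F : Fin R.length → ℝ → ℂ)
    (hv : ∀ i x, v i x = (((Icc (-c') c').indicator (g i) x : ℝ) : ℂ))
    {B : ℝ} (hB0 : 0 ≤ B) (hB : ∀ i : Fin R.length, ∀ x, c' < |x| → |x| ≤ bp → |g i x| ≤ B)
    (hF : ∀ i y, F i y = (Icc (-c) c).indicator (fun y ↦
        2 * (∫ x, v i x * (Real.cosh (x / 2) : ℂ)) * (Real.cosh (y / 2) : ℂ) -
          2 * (∫ x, v i x * (Real.sinh (x / 2) : ℂ)) * (Real.sinh (y / 2) : ℂ) +
        (∑ m ∈ weilPrimeIndex c, (((ArithmeticFunction.vonMangoldt m : ℝ) / Real.sqrt m : ℝ) : ℂ) *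
          (2 * v i y - v i (y - Real.log m) - v i (y + Real.log m))) +
        ∫ t in Ioi 0, (weilArchDensity t : ℂ) * (2 * v i y - v i (y - t) - v i (y + t))) y -
      (weilMarkovConstant c : ℂ) * v i y)
    (W : Fin R.length → Fin R.length → ℝ) {κ₂ : ℝ} (hκ : Real.log 2 / 2 ≤ κ₂) (lam : ℝ)
    {y₁ : ℝ} (hy : y₁ ≤ Real.log 4 - c) (hyc : y₁ ≤ c')
    {wI wE wS : ℝ} (hwI0 : 0 < wI) (hwE0 : 0 < wE) (hwS0 : 0 < wS)
    (hwI : 1 / wI ≤ β₂₃ - lam - 4 * (c * ε ^ 2) * ∑ i : Fin R.length, ((R.get i).1 : ℝ))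
    (hwE : 1 / wE ≤ β₂₃ - κ₂ - lam - 4 * (c * ε ^ 2) * ∑ i : Fin R.length, ((R.get i).1 : ℝ))
    (hwS : 1 / wS ≤ β₂₃ - κ₂ - lam - 4 * (c * ε ^ 2) * ∑ i : Fin R.length, ((R.get i).1 : ℝ) -
      8 * ((bp - c') * B ^ 2) * ∑ i : Fin R.length, ((R.get i).1 : ℝ))
    (hPSD : ∀ α : Fin R.length → ℝ, 0 ≤ ∑ i, ∑ j, α i * α j *
      ((weilPoleForm₂ (v i) (v j) + weilDirichletEnergy₂ c (v i) (v j) -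
          weilMarkovConstant c * ∫ x, (v i x * conj (v j x)).re) - lam * (∫ x, (v i x * conj (v j x)).re) -
        ∫ y, {u : ℝ | c' < |u|}.piecewise (fun _ ↦ wS)
            ({u : ℝ | y₁ ≤ |u|}.piecewise (fun _ ↦ wE) (fun _ ↦ wI)) y *
          ((F i - ∑ l, W i l • v l) y * conj ((F j - ∑ l, W j l • v l) y)).re)) :
    lam ≤ weilEvenGroundEnergy c := by
  have hc : 0 < c := lt_of_lt_of_le hc' hcc
  refine le_weilEvenGroundEnergy_of_forall hc fun φ hφ hφs hφe hφn ↦ ?_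
  have h := dt_sector_bound_of_deflCert_w_inner 1 hc' hcc hc5 hca hcb R n hRμ
    (fun f hf hfs hfp ↦ hcert23 f hf hfs (fun x ↦ by simpa using hfp x)) g hg (fun i x ↦ by rw [hge i x, one_mul])
    hg0 hε0 hε v F hv hB0 hB hF W hκ lam hy hyc hwI0 hwE0 hwS0 hwI hwE hwS hPSD hφ hφs (fun x ↦ by simpa using hφe x)
  rwa [hφn, mul_one] at h

/-- **The deflated Temple ODD-sector bound from a rank-one augmented two-prime certificate, trial vectors cut inside
the window.**  `λ ≤ ε_od(c)` under the hypotheses of `dt_sector_bound_of_deflCert_w_inner` with odd trial polynomials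
and the certificate on the odd tests of `[-a₀, a₀]`. [folklore] -/
theorem dt_weilOddGroundEnergy_ge_of_deflCert_w_inner {c c' : ℝ} (hc' : 0 < c') (hcc : c' ≤ c)
    (hc5 : c ≤ Real.log 5 / 2) {a₀ : ℝ} (hca : c ≤ a₀) {bp : ℝ} (hcb : c ≤ bp)
    (R : List (ℚ × ℕ × List ℚ)) (n : ℕ) {β₂₃ : ℝ}
    (hRμ : ∀ i : Fin R.length, 0 ≤ (R.get i).1)
    (hcert23 : ∀ f : ℝ → ℂ, IsWeilTest f → tsupport f ⊆ Icc (-a₀) a₀ → (∀ x, f (-x) = -f x) →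
      β₂₃ * weilNorm2Sq f ≤ weilTwoPrimeQuadratic f +
        (R.map fun r ↦ (r.1 : ℝ) * ‖∑ k ∈ Finset.range n, ((maskV r k : ℚ) : ℂ) * weilMoment a₀ f k‖ ^ 2).sum)
    (g : Fin R.length → ℝ → ℝ) (hg : ∀ i, ContDiff ℝ 1 (g i)) (hgo : ∀ i x, g i (-x) = -g i x)
    (hg0 : ∀ i, g i c' = 0)
    {ε : ℝ} (hε0 : 0 ≤ ε) (hε : ∀ i, ∀ x ∈ Icc (-c) c, |maskPoly (R.get i) n a₀ x - g i x| ≤ ε)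
    (v F : Fin R.length → ℝ → ℂ)
    (hv : ∀ i x, v i x = (((Icc (-c') c').indicator (g i) x : ℝ) : ℂ))
    {B : ℝ} (hB0 : 0 ≤ B) (hB : ∀ i : Fin R.length, ∀ x, c' < |x| → |x| ≤ bp → |g i x| ≤ B)
    (hF : ∀ i y, F i y = (Icc (-c) c).indicator (fun y ↦
        2 * (∫ x, v i x * (Real.cosh (x / 2) : ℂ)) * (Real.cosh (y / 2) : ℂ) -
          2 * (∫ x, v i x * (Real.sinh (x / 2) : ℂ)) * (Real.sinh (y / 2) : ℂ) +
        (∑ m ∈ weilPrimeIndex c, (((ArithmeticFunction.vonMangoldt m : ℝ) / Real.sqrt m : ℝ) : ℂ) *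
          (2 * v i y - v i (y - Real.log m) - v i (y + Real.log m))) +
        ∫ t in Ioi 0, (weilArchDensity t : ℂ) * (2 * v i y - v i (y - t) - v i (y + t))) y -
      (weilMarkovConstant c : ℂ) * v i y)
    (W : Fin R.length → Fin R.length → ℝ) {κ₂ : ℝ} (hκ : Real.log 2 / 2 ≤ κ₂) (lam : ℝ)
    {y₁ : ℝ} (hy : y₁ ≤ Real.log 4 - c) (hyc : y₁ ≤ c')
    {wI wE wS : ℝ} (hwI0 : 0 < wI) (hwE0 : 0 < wE) (hwS0 : 0 < wS)
    (hwI : 1 / wI ≤ β₂₃ - lam - 4 * (c * ε ^ 2) * ∑ i : Fin R.length, ((R.get i).1 : ℝ))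
    (hwE : 1 / wE ≤ β₂₃ - κ₂ - lam - 4 * (c * ε ^ 2) * ∑ i : Fin R.length, ((R.get i).1 : ℝ))
    (hwS : 1 / wS ≤ β₂₃ - κ₂ - lam - 4 * (c * ε ^ 2) * ∑ i : Fin R.length, ((R.get i).1 : ℝ) -
      8 * ((bp - c') * B ^ 2) * ∑ i : Fin R.length, ((R.get i).1 : ℝ))
    (hPSD : ∀ α : Fin R.length → ℝ, 0 ≤ ∑ i, ∑ j, α i * α j *
      ((weilPoleForm₂ (v i) (v j) + weilDirichletEnergy₂ c (v i) (v j) -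
          weilMarkovConstant c * ∫ x, (v i x * conj (v j x)).re) - lam * (∫ x, (v i x * conj (v j x)).re) -
        ∫ y, {u : ℝ | c' < |u|}.piecewise (fun _ ↦ wS)
            ({u : ℝ | y₁ ≤ |u|}.piecewise (fun _ ↦ wE) (fun _ ↦ wI)) y *
          ((F i - ∑ l, W i l • v l) y * conj ((F j - ∑ l, W j l • v l) y)).re)) :
    lam ≤ weilOddGroundEnergy c := by
  have hc : 0 < c := lt_of_lt_of_le hc' hcc
  refine le_weilOddGroundEnergy_of_forall hc fun φ hφ hφs hφo hφn ↦ ?_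
  have h := dt_sector_bound_of_deflCert_w_inner (-1) hc' hcc hc5 hca hcb R n hRμ
    (fun f hf hfs hfp ↦ hcert23 f hf hfs (fun x ↦ by simpa using hfp x)) g hg (fun i x ↦ by rw [hgo i x]; ring)
    hg0 hε0 hε v F hv hB0 hB hF W hκ lam hy hyc hwI0 hwE0 hwS0 hwI hwE hwS hPSD hφ hφs (fun x ↦ by simpa using hφo x)
  rwa [hφn, mul_one] at h

end Summit.RiemannHypothesis.RiemannHypothesis.Theorems.EvenWinsBeyondArch

end
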